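import Mathlib
import Summits.PneNP.PneNP.Theorems.SfmBlBlockDisc
import Summits.PneNP.PneNP.Theorems.SfmBlConnectedPairs
import Summits.PneNP.PneNP.Theorems.SfmBlConnectedCount

/-!
# Connected pairs: rectangle forms and counting — line «sfm-bl» (PROOF-SFM-BL Lemma 3 ⇒ BL 3.3 input; Lemma 5 for pairs)

FRONTIER F-N1c; nothing here bears on P vs NP.

Vocabulary for PAIRS of a bipartite (multi)graph given by a relation `E ⊆ α × β` (rows `α` left,
columns `β` right): the bipartite simple graph `bipGraph E` on `α ⊕ β` and
`IsConnectedPair E W₁ W₂` — the subgraph of `bipGraph E` induced on `W₁ ⊕ W₂` is connected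
(PROOF-SFM-BL §2 «connected pair»; parallel edges and signs do not affect connectivity, so a
multigraph enters only through the relation «some edge joins `i` and `j`»; the convention
`(G.induce ↑S).Connected` is the one of `SfmBlConnectedCount` / `SfmBlConnectedPairs`).

* `rect_of_connectedPairs` — PROOF-SFM-BL Lemma 3 in RECTANGLE (Finset-sum) language: a bound
  `|Σ_{i∈W₁} Σ_{j∈W₂} M i j| ≤ γ √(|W₁|·|W₂|)` on the nonempty connected pairs of a relation
  `E ⊇ supp M` extends to all pairs.  DERIVED from the landed 0/1-vector form
  `SfmBl.disc_of_connected_pairs` (p3) with `G = bipGraph E` and indicator vectors — no new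
  mathematics, only the Finset ↔ indicator dictionary.
* `rect_fromBlocks` — transport to the symmetric bipartite double `A = fromBlocks 0 M Mᵀ 0` on
  `α ⊕ β`: `|Σ_{a∈S} Σ_{b∈T} A a b| ≤ γ √(|S|·|T|)` for ALL `S, T` (split by sides;
  `√(ps) + √(qr) ≤ √((p+q)(r+s))`).  This is exactly the hypothesis `hA` of the tree's Bilu–Linial
  Lemma 3.3, `Literature.Combinatorics.Expanders.BiluLinial2006_lemma_3_3_explicit`
  (PROOF-SFM-BL Lemma 6, discharged there), so `rect_fromBlocks_of_connectedPairs` is the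
  end-to-end form consumed by Prop. 7.
* `card_connectedPairs_through_le` / `card_connectedPairs_le` — PROOF-SFM-BL Lemma 5 for pairs:
  with all degrees of `bipGraph E` at most `L`, the connected pairs of total size `n + 1` through a
  vertex number `≤ L^(2n)` (`≤ (|α|+|β|)·L^(2n)` in total), from `SfmBl.card_connectedThrough_le`
  via the injection `(W₁, W₂) ↦ W₁ ⊕ W₂`.
-/

namespace Summit.PneNP.PneNP.Theorems.SfmBl

open Matrix Finset BigOperators SimpleGraph

variable {α β : Type*}

/-! ## The bipartite graph of a relation and connected pairs -/

/-- The bipartite simple graph of a relation `E ⊆ α × β`: vertices `α ⊕ β` (rows left, columns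
right), `inl i` adjacent to `inr j` iff `E i j`; no edges inside a side. -/
def bipGraph (E : α → β → Prop) : SimpleGraph (α ⊕ β) where
  Adj x y := match x, y with
    | Sum.inl i, Sum.inr j => E i j
    | Sum.inr j, Sum.inl i => E i j
    | Sum.inl _, Sum.inl _ => False
    | Sum.inr _, Sum.inr _ => False
  symm := ⟨by
    intro x y h
    cases x with
    | inl i => cases y with
      | inl i' => exact h.elim
      | inr j' => exact h
    | inr j => cases y with
      | inl i' => exact h
      | inr j' => exact h.elim⟩
  loopless := ⟨by
    intro x h
    cases x with
    | inl i => exact h.elim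
    | inr j => exact h.elim⟩

/-- `inl i ~ inr j` in `bipGraph E` iff `E i j`. -/
theorem bipGraph_adj_inl_inr (E : α → β → Prop) (i : α) (j : β) :
    (bipGraph E).Adj (Sum.inl i) (Sum.inr j) ↔ E i j := Iff.rfl

/-- `inr j ~ inl i` in `bipGraph E` iff `E i j`. -/
theorem bipGraph_adj_inr_inl (E : α → β → Prop) (i : α) (j : β) :
    (bipGraph E).Adj (Sum.inr j) (Sum.inl i) ↔ E i j := Iff.rfl

/-- No edges inside the left side. -/
theorem bipGraph_not_adj_inl_inl (E : α → β → Prop) (i i' : α) :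
    ¬ (bipGraph E).Adj (Sum.inl i) (Sum.inl i') := fun h => h.elim

/-- No edges inside the right side. -/
theorem bipGraph_not_adj_inr_inr (E : α → β → Prop) (j j' : β) :
    ¬ (bipGraph E).Adj (Sum.inr j) (Sum.inr j') := fun h => h.elim

/-- The bipartite graph is monotone in the relation. -/
theorem bipGraph_mono {E E' : α → β → Prop} (h : ∀ i j, E i j → E' i j) :
    bipGraph E ≤ bipGraph E' := by
  intro x y hx
  cases x with
  | inl i => cases y with
    | inl i' => exact hx.elim
    | inr j' => exact h _ _ hx
  | inr j => cases y with
    | inl i' => exact h _ _ hx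
    | inr j' => exact hx.elim

/-- CONNECTED PAIR (PROOF-SFM-BL §2): `(W₁, W₂)` with `W₁ ⊆ α`, `W₂ ⊆ β` is a connected pair of
the relation `E` iff the subgraph of `bipGraph E` induced on `W₁ ⊕ W₂` is connected (in
particular `W₁ ⊕ W₂` is nonempty). -/
def IsConnectedPair (E : α → β → Prop) (W₁ : Finset α) (W₂ : Finset β) : Prop :=
  ((bipGraph E).induce ((W₁.disjSum W₂ : Finset (α ⊕ β)) : Set (α ⊕ β))).Connected

/-- Connected pairs are monotone in the relation (more edges keep a pair connected). -/
theorem IsConnectedPair.mono {E E' : α → β → Prop} (h : ∀ i j, E i j → E' i j)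
    {W₁ : Finset α} {W₂ : Finset β} (hc : IsConnectedPair E W₁ W₂) : IsConnectedPair E' W₁ W₂ :=
  SimpleGraph.Connected.mono (fun _ _ hab => bipGraph_mono h hab) hc

/-- A connected pair has a nonempty vertex set `W₁ ⊕ W₂`. -/
theorem IsConnectedPair.nonempty {E : α → β → Prop} {W₁ : Finset α} {W₂ : Finset β}
    (hc : IsConnectedPair E W₁ W₂) : (W₁.disjSum W₂).Nonempty := by
  obtain ⟨⟨x, hx⟩⟩ := SimpleGraph.Connected.nonempty hc
  exact ⟨x, Finset.mem_coe.1 hx⟩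

/-! ## Lemma 3 in rectangle form (from `disc_of_connected_pairs`) -/

section Reduction

variable [Fintype α] [Fintype β] [DecidableEq α] [DecidableEq β]

/-- The bilinear form on indicator vectors is the rectangle sum. -/
theorem indicator_dotProduct_mulVec_indicator (M : Matrix α β ℝ) (W₁ : Finset α) (W₂ : Finset β) :
    (fun i => if i ∈ W₁ then (1 : ℝ) else 0) ⬝ᵥ (M *ᵥ fun j => if j ∈ W₂ then (1 : ℝ) else 0)
      = ∑ i ∈ W₁, ∑ j ∈ W₂, M i j := by
  simp only [dotProduct, Matrix.mulVec, ite_mul, one_mul, zero_mul, mul_ite, mul_one, mul_zero,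
    Finset.sum_ite_mem, Finset.univ_inter]

omit [Fintype β] [DecidableEq β] in
/-- An indicator vector sums to the cardinality. -/
theorem sum_indicator_eq_card (W : Finset α) : ∑ i, (if i ∈ W then (1 : ℝ) else 0) = W.card := by
  rw [Finset.sum_ite_mem, Finset.univ_inter, Finset.sum_const, nsmul_eq_mul, mul_one]

/-- **PROOF-SFM-BL LEMMA 3, RECTANGLE FORM.**  `M` is supported inside the relation `E`; if
`|Σ_{i∈W₁} Σ_{j∈W₂} M i j| ≤ γ √(|W₁|·|W₂|)` holds for every connected pair of `E` with both sides
nonempty, it holds for every pair.  (From `SfmBl.disc_of_connected_pairs` with `G = bipGraph E`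
and indicator vectors.) -/
theorem rect_of_connectedPairs (M : Matrix α β ℝ) (E : α → β → Prop)
    (hME : ∀ i j, M i j ≠ 0 → E i j) {γ : ℝ} (hγ : 0 ≤ γ)
    (h : ∀ (W₁ : Finset α) (W₂ : Finset β), W₁.Nonempty → W₂.Nonempty → IsConnectedPair E W₁ W₂ →
      |∑ i ∈ W₁, ∑ j ∈ W₂, M i j| ≤ γ * Real.sqrt ((W₁.card : ℝ) * (W₂.card : ℝ)))
    (W₁ : Finset α) (W₂ : Finset β) :
    |∑ i ∈ W₁, ∑ j ∈ W₂, M i j| ≤ γ * Real.sqrt ((W₁.card : ℝ) * (W₂.card : ℝ)) := by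
  classical
  have h01a : ∀ i : α, (if i ∈ W₁ then (1 : ℝ) else 0) = 0 ∨ (if i ∈ W₁ then (1 : ℝ) else 0) = 1 :=
    fun i => by by_cases hi : i ∈ W₁ <;> simp [hi]
  have h01b : ∀ j : β, (if j ∈ W₂ then (1 : ℝ) else 0) = 0 ∨ (if j ∈ W₂ then (1 : ℝ) else 0) = 1 :=
    fun j => by by_cases hj : j ∈ W₂ <;> simp [hj]
  have hmain := disc_of_connected_pairs M (bipGraph E)
    (fun i j hM => (bipGraph_adj_inl_inr E i j).2 (hME i j hM)) hγ ?_
    (fun i => if i ∈ W₁ then (1 : ℝ) else 0) (fun j => if j ∈ W₂ then (1 : ℝ) else 0)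
    h01a h01b
  · rwa [indicator_dotProduct_mulVec_indicator, sum_indicator_eq_card, sum_indicator_eq_card] at hmain
  -- the hypothesis of `disc_of_connected_pairs`: translate a connected 0/1 pair into a connected pair
  intro u v hu hv hconn
  let U : Finset α := Finset.univ.filter fun i => u i = 1
  let V : Finset β := Finset.univ.filter fun j => v j = 1
  have hu' : u = fun i => if i ∈ U then (1 : ℝ) else 0 := by
    funext i
    rcases hu i with h0 | h1
    · simp [U, h0]
    · simp [U, h1]
  have hv' : v = fun j => if j ∈ V then (1 : ℝ) else 0 := by
    funext j
    rcases hv j with h0 | h1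
    · simp [V, h0]
    · simp [V, h1]
  have hset : {x : α ⊕ β | Sum.elim u v x = 1} = ((U.disjSum V : Finset (α ⊕ β)) : Set (α ⊕ β)) := by
    ext x
    cases x with
    | inl i => simp [U, Finset.mem_disjSum]
    | inr j => simp [V, Finset.mem_disjSum]
  have hconn' : IsConnectedPair E U V := by
    unfold IsConnectedPair
    rw [← hset]
    exact hconn
  rw [hu', hv', indicator_dotProduct_mulVec_indicator, sum_indicator_eq_card, sum_indicator_eq_card]
  by_cases hU : U.Nonempty
  · by_cases hV : V.Nonempty
    · exact h U V hU hV hconn'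
    · rw [Finset.not_nonempty_iff_eq_empty.1 hV]
      simp only [Finset.sum_empty, Finset.sum_const_zero, abs_zero]
      exact mul_nonneg hγ (Real.sqrt_nonneg _)
  · rw [Finset.not_nonempty_iff_eq_empty.1 hU]
    simp only [Finset.sum_empty, abs_zero]
    exact mul_nonneg hγ (Real.sqrt_nonneg _)

omit [Fintype α] [Fintype β] [DecidableEq α] [DecidableEq β] in
/-- **SYMMETRIC RECTANGLE FORM** (the shape `hA` of the tree's Bilu–Linial Lemma 3.3,
`Literature.Combinatorics.Expanders.BiluLinial2006_lemma_3_3_explicit`).  If every side pair of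
`M` obeys `|Σ_{W₁×W₂} M| ≤ γ √(|W₁|·|W₂|)`, then the symmetric bipartite matrix
`A = fromBlocks 0 M Mᵀ 0` on `α ⊕ β` obeys `|Σ_{a∈S} Σ_{b∈T} A a b| ≤ γ √(|S|·|T|)` for ALL
`S, T ⊆ α ⊕ β` (disjointness is not needed): split `S, T` by sides, the two surviving blocks are
side pairs, and `√(p s) + √(q r) ≤ √((p+q)(r+s))`. -/
theorem rect_fromBlocks (M : Matrix α β ℝ) {γ : ℝ} (hγ : 0 ≤ γ)
    (h : ∀ (W₁ : Finset α) (W₂ : Finset β),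
      |∑ i ∈ W₁, ∑ j ∈ W₂, M i j| ≤ γ * Real.sqrt ((W₁.card : ℝ) * (W₂.card : ℝ)))
    (S T : Finset (α ⊕ β)) :
    |∑ a ∈ S, ∑ b ∈ T, Matrix.fromBlocks (0 : Matrix α α ℝ) M Mᵀ (0 : Matrix β β ℝ) a b|
      ≤ γ * Real.sqrt ((S.card : ℝ) * (T.card : ℝ)) := by
  classical
  -- split the double sum by sides
  have hT : ∀ f : α ⊕ β → ℝ,
      ∑ b ∈ T, f b = ∑ i ∈ T.toLeft, f (Sum.inl i) + ∑ j ∈ T.toRight, f (Sum.inr j) := by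
    intro f
    conv_lhs => rw [← Finset.toLeft_disjSum_toRight (u := T)]
    rw [Finset.sum_disjSum]
  have hS' : ∀ f : α ⊕ β → ℝ,
      ∑ a ∈ S, f a = ∑ i ∈ S.toLeft, f (Sum.inl i) + ∑ j ∈ S.toRight, f (Sum.inr j) := by
    intro f
    conv_lhs => rw [← Finset.toLeft_disjSum_toRight (u := S)]
    rw [Finset.sum_disjSum]
  have hsplit : ∑ a ∈ S, ∑ b ∈ T, Matrix.fromBlocks (0 : Matrix α α ℝ) M Mᵀ (0 : Matrix β β ℝ) a b
      = ∑ i ∈ S.toLeft, ∑ j ∈ T.toRight, M i j + ∑ i ∈ T.toLeft, ∑ j ∈ S.toRight, M i j := by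
    rw [hS']
    simp only [hT, Matrix.fromBlocks_apply₁₁, Matrix.fromBlocks_apply₁₂,
      Matrix.fromBlocks_apply₂₁, Matrix.fromBlocks_apply₂₂, Matrix.zero_apply,
      Matrix.transpose_apply, Finset.sum_const_zero, zero_add, add_zero]
    rw [Finset.sum_comm (s := S.toRight) (t := T.toLeft)]
  -- the two block bounds and the square-root inequality
  have h1 := h S.toLeft T.toRight
  have h2 := h T.toLeft S.toRight
  have hcs := sum_sqrt_mul_le (Finset.univ : Finset (Fin 2))
    ![(S.toLeft.card : ℝ), (S.toRight.card : ℝ)] ![(T.toRight.card : ℝ), (T.toLeft.card : ℝ)]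
    (fun b => by fin_cases b <;> simp) (fun b => by fin_cases b <;> simp)
  simp only [Fin.sum_univ_two, Matrix.cons_val_zero, Matrix.cons_val_one] at hcs
  have hS : (S.toLeft.card : ℝ) + (S.toRight.card : ℝ) = S.card := by
    exact_mod_cast Finset.card_toLeft_add_card_toRight (u := S)
  have hT' : (T.toRight.card : ℝ) + (T.toLeft.card : ℝ) = T.card := by
    rw [add_comm]; exact_mod_cast Finset.card_toLeft_add_card_toRight (u := T)
  rw [hS, hT'] at hcs
  rw [hsplit]
  calc |∑ i ∈ S.toLeft, ∑ j ∈ T.toRight, M i j + ∑ i ∈ T.toLeft, ∑ j ∈ S.toRight, M i j|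
      ≤ |∑ i ∈ S.toLeft, ∑ j ∈ T.toRight, M i j| + |∑ i ∈ T.toLeft, ∑ j ∈ S.toRight, M i j| :=
        abs_add_le _ _
    _ ≤ γ * Real.sqrt ((S.toLeft.card : ℝ) * (T.toRight.card : ℝ))
          + γ * Real.sqrt ((T.toLeft.card : ℝ) * (S.toRight.card : ℝ)) := add_le_add h1 h2
    _ = γ * (Real.sqrt ((S.toLeft.card : ℝ) * (T.toRight.card : ℝ))
          + Real.sqrt ((S.toRight.card : ℝ) * (T.toLeft.card : ℝ))) := by
        rw [mul_comm (T.toLeft.card : ℝ)]; ring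
    _ ≤ γ * Real.sqrt ((S.card : ℝ) * (T.card : ℝ)) := mul_le_mul_of_nonneg_left hcs hγ

/-- **END-TO-END FORM** (PROOF-SFM-BL Lemma 3 as consumed by Prop. 7): from the discrepancy bound on
nonempty connected pairs of a relation `E ⊇ supp M` to the rectangle hypothesis `hA` of the tree's
Bilu–Linial Lemma 3.3 for `A = fromBlocks 0 M Mᵀ 0`. -/
theorem rect_fromBlocks_of_connectedPairs (M : Matrix α β ℝ) (E : α → β → Prop)
    (hME : ∀ i j, M i j ≠ 0 → E i j) {γ : ℝ} (hγ : 0 ≤ γ)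
    (h : ∀ (W₁ : Finset α) (W₂ : Finset β), W₁.Nonempty → W₂.Nonempty → IsConnectedPair E W₁ W₂ →
      |∑ i ∈ W₁, ∑ j ∈ W₂, M i j| ≤ γ * Real.sqrt ((W₁.card : ℝ) * (W₂.card : ℝ)))
    (S T : Finset (α ⊕ β)) :
    |∑ a ∈ S, ∑ b ∈ T, Matrix.fromBlocks (0 : Matrix α α ℝ) M Mᵀ (0 : Matrix β β ℝ) a b|
      ≤ γ * Real.sqrt ((S.card : ℝ) * (T.card : ℝ)) :=
  rect_fromBlocks M hγ (rect_of_connectedPairs M E hME hγ h) S T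

end Reduction

/-! ## Counting connected pairs (PROOF-SFM-BL Lemma 5 for pairs) -/

section Counting

-- `SfmBl.card_connectedThrough_le` lives in `Type` (universe 0), hence so do these corollaries.
variable {α₀ β₀ : Type} [Fintype α₀] [Fintype β₀] [DecidableEq α₀] [DecidableEq β₀]

/-- **CONNECTED PAIRS THROUGH A VERTEX**: if every vertex of `bipGraph E` has degree `≤ L`, the
connected pairs `(W₁, W₂)` of total size `|W₁| + |W₂| = n + 1` whose vertex set `W₁ ⊕ W₂`
contains a given vertex `x` number at most `L ^ (2 n)` (from `SfmBl.card_connectedThrough_le` via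
the injection `(W₁, W₂) ↦ W₁ ⊕ W₂`). -/
theorem card_connectedPairs_through_le (E : α₀ → β₀ → Prop) [DecidableRel (bipGraph E).Adj] {L : ℕ}
    (hdeg : ∀ x, (bipGraph E).degree x ≤ L) (x : α₀ ⊕ β₀) (n : ℕ) :
    Nat.card {W : Finset α₀ × Finset β₀ //
        x ∈ W.1.disjSum W.2 ∧ W.1.card + W.2.card = n + 1 ∧ IsConnectedPair E W.1 W.2}
      ≤ L ^ (2 * n) := by
  classical
  let f : {W : Finset α₀ × Finset β₀ //
        x ∈ W.1.disjSum W.2 ∧ W.1.card + W.2.card = n + 1 ∧ IsConnectedPair E W.1 W.2} →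
      {S : Finset (α₀ ⊕ β₀) // x ∈ S ∧ S.card = n + 1 ∧ ((bipGraph E).induce (S : Set (α₀ ⊕ β₀))).Connected} :=
    fun W => ⟨W.1.1.disjSum W.1.2, W.2.1, by rw [Finset.card_disjSum]; exact W.2.2.1, W.2.2.2⟩
  have hf : Function.Injective f := by
    intro a b hab
    have h' : a.1.1.disjSum a.1.2 = b.1.1.disjSum b.1.2 := congrArg Subtype.val hab
    apply Subtype.ext
    exact Prod.ext (by simpa using congrArg Finset.toLeft h') (by simpa using congrArg Finset.toRight h')
  calc Nat.card {W : Finset α₀ × Finset β₀ //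
          x ∈ W.1.disjSum W.2 ∧ W.1.card + W.2.card = n + 1 ∧ IsConnectedPair E W.1 W.2}
      ≤ Nat.card {S : Finset (α₀ ⊕ β₀) //
          x ∈ S ∧ S.card = n + 1 ∧ ((bipGraph E).induce (S : Set (α₀ ⊕ β₀))).Connected} :=
        Nat.card_le_card_of_injective f hf
    _ ≤ L ^ (2 * n) := card_connectedThrough_le (bipGraph E) hdeg x n

/-- **ALL CONNECTED PAIRS OF A GIVEN SIZE**: with all degrees of `bipGraph E` at most `L`, the
connected pairs of total size `n + 1` number at most `(|α₀| + |β₀|) · L ^ (2 n)`. -/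
theorem card_connectedPairs_le (E : α₀ → β₀ → Prop) [DecidableRel (bipGraph E).Adj] {L : ℕ}
    (hdeg : ∀ x, (bipGraph E).degree x ≤ L) (n : ℕ) :
    Nat.card {W : Finset α₀ × Finset β₀ // W.1.card + W.2.card = n + 1 ∧ IsConnectedPair E W.1 W.2}
      ≤ (Fintype.card α₀ + Fintype.card β₀) * L ^ (2 * n) := by
  classical
  let f : {W : Finset α₀ × Finset β₀ // W.1.card + W.2.card = n + 1 ∧ IsConnectedPair E W.1 W.2} →
      {S : Finset (α₀ ⊕ β₀) // S.card = n + 1 ∧ ((bipGraph E).induce (S : Set (α₀ ⊕ β₀))).Connected} :=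
    fun W => ⟨W.1.1.disjSum W.1.2, by rw [Finset.card_disjSum]; exact W.2.1, W.2.2⟩
  have hf : Function.Injective f := by
    intro a b hab
    have h' : a.1.1.disjSum a.1.2 = b.1.1.disjSum b.1.2 := congrArg Subtype.val hab
    apply Subtype.ext
    exact Prod.ext (by simpa using congrArg Finset.toLeft h') (by simpa using congrArg Finset.toRight h')
  calc Nat.card {W : Finset α₀ × Finset β₀ // W.1.card + W.2.card = n + 1 ∧ IsConnectedPair E W.1 W.2}
      ≤ Nat.card {S : Finset (α₀ ⊕ β₀) // S.card = n + 1 ∧ ((bipGraph E).induce (S : Set (α₀ ⊕ β₀))).Connected} :=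
        Nat.card_le_card_of_injective f hf
    _ ≤ Fintype.card (α₀ ⊕ β₀) * L ^ (2 * n) := card_connectedSets_le (bipGraph E) hdeg n
    _ = (Fintype.card α₀ + Fintype.card β₀) * L ^ (2 * n) := by rw [Fintype.card_sum]

end Counting

end Summit.PneNP.PneNP.Theorems.SfmBl
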